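import Summits.QuantumFields.YangMills.Theorems.BalabanUVNodesN12AtTheta13OfThm1CC1
import Literature.MathematicalPhysics.QuantumFieldTheory.Balaban1983to89.Node00.Record13CarriersSepCoPH
import Literature.MathematicalPhysics.QuantumFieldTheory.Balaban1983to89.Node00.Record13SepCoPRInhabitedOfSepCoP
import Literature.MathematicalPhysics.QuantumFieldTheory.Balaban1983to89.Node00.N24GlueStage13C
import Literature.MathematicalPhysics.QuantumFieldTheory.Balaban1983to89.Node00.N24NodesStage13FourPinPointedCoP
import Literature.MathematicalPhysics.QuantumFieldTheory.Balaban1983to89.B16RLeafRecord13LiveCoPH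

/-!
# BalabanUVNodes ∕ N12 — THE BODY OF THE K1⁷ RUNG v5 `NodesAtSomeRecord13PWS` (plan D71-REV24 `dryrun-skel/K1Skeleton13SepCoPHv5.lean` = the registered v4 rung of stmt-QuantumFields-20507 under T₇: S-BOUND world `RecordS` over `Stage13HParams` ∕
# `Provisos₁₃SepCoPH` ∕ `toStage5₁₃CoPH` ∕ `upOfRecord₅CS`, guard `ZhUnity ∧ SlotsNondegenerate₁₃`, N08 AND N12 PINNED BY NAME) OVER AN S-BOUND GENERIC-`W₀` FOUR-PIN VIEW OF A v1.7 `CoPH` PARAMETER (node00-def-T FILE 27∕28T p537939∕p539169: the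
# HISTORY-INDEXED residual 𝐓-weight slot `Zh` — FINDING №9, director-ym №183 H1ʰ ∕ №186 (α) ∕ PRESS WORD №190), N12 (MIXED W-PIN, 12E) AND N13 (dag-n11-e's v1.7 live chain `B16RLeafRecord13LiveCoPH`) RESOLVED — at the H-EXTENSION `⟨⟨Θ.liveRepin₁₃, Zr⟩,
# Zh, Phih⟩` of the live re-pin of any `Θ` carrying node00-def-K0b's residuals (all three slots free), at the DOOR-CURED PIN `Stage13HParams.ofHistoryBlind (Stage13RParams.ofCured (Θ.liveRepin₁₃))` (FILE 27 §H1 ∘ K0a FILE 18), and at the door-cured pin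
# of the C¹ route's witness `θ₁₅ᶜᶜ¹` — the T₇ twin (generator `work/mk_coph.py` over the TREE text) of this seat's 12T `BalabanUVNodesN12AtRecord13SepCoPRSockets` (p536153) (Track A, DAG node N12 = [B15, Balaban1989LargeFieldI] CMP **122** (1989)
# 175–202; cluster K1: K1⁷ `StabilityBAtRecordR13SepCoPH`, stubs `stub_nodes13PWS` ∕ `stub_betaWindow13PWS` under T₇; the ⁶ key stmt-QuantumFields-20507 STANDS until «KEY-24 SERVED»; seat `pub-ymgap-dag-n12-d` g12 (R134 s2 «knit at the record»),
# 2026-08-27; count-neutral, NOT a discharge)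

HONEST FRAMING.  Count-neutral kernel COMPOSITION BY NAME.  §0 is the S-BOUND GENERIC-`W₀` FOUR-PIN ENGINE at v1.7: dag-n24-c's C-bound W₀ engine `N24_nodes₁₃B10YZW₀_pointed_coP` (p524398) carried to node00-def's S-BINDING `upOfRecord₅CS` (`CarriersB8`:
the C-binding with `b8` re-bound to [6] Thm 8's SURVIVING form) by dag-n24-c's own transport (p529950 §1: every non-`b8` leaf and `rOperation` is the C-binding's by `withB8_leaves` ∕ `upOfRecord₅CS_eq_withB8`, `rfl`; N01 ∕ N02 ∕ N04 from the C-bound TWIN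
world through `leavesP_eq_of_up_withB8` by node00-def-T's transferred CoPH faces `b4∕b5∕b7_main_of_isRecordOfRecord₁₃CCoPH`, N03 by node00-def-T's `atWorld_of_isRecordOfRecord₁₃CCoPH` over dag-n24-c's Stage-5 theorem `N03_at_record₅C` — no N24 `CoPH` glue
module is needed; N05 := the DISPLAYED surviving leaf `h05S`; N10 at the twin by `b13_main_at_stage5ParamsC`; N11 ∕ N13 by dag-n11-a's ∕ dag-n11-e's construction-generic knits along `SLaw₁₃CoPH ∕ TLaw₁₃CoPH`, `rOpLeaf_VOfRecord₁₃CoPH_iff`,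
`coreOfRecord₁₃CoPH`, `datumOfRecord₁₃CoPH_C`, `sLaw₁₃CoPH_zero` — FILE 27), over dag-n10-d's H-LEVEL PINS (W1 `Record13CarriersCoPH` p539476 ∕ W2 `Record13CarriersSepCoPH`: `Stage13HParams.pin{B10,Y,Z,W}`, `Provisos₁₃(Sep)CoPH.pin*`,
`datumOfRecord₁₃(Sep)CoPH_pin*` `rfl`, `toStage5₁₃CoPH_pin*` `rfl`).  WHY HERE (as at v1.6): the view-form S-bound engines pin `W := WOfRecord₁₃ θ λ` on EVERY run, whereas the rung demands [IV]'s basic step at the bundle of record ONLY on runs with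
`λ.kSel P < P.K` («runs with `K = 0` have no step and carry no demand»); the MIXED W-PIN (12J §3 ∕ 12V-H) — `W₀ P := WOfRecord₁₃ θ.toStage13Params λ P` below the torus, a leaf-carrying `W₀ P` (e.g. g4's degenerate carrier) on `K = 0` runs — needs the
generic-`W₀` S-bound world.  Then the v5 conjuncts come BY NAME: guard `SlotsNondegenerate₁₃` from K0b's residuals (K0a FILE 9 v1.1), `ZhUnity` DISPLAYED at generic slots (`hZh`) and a THEOREM at the door-cured pin (`(zrUnity_ofCured _).ofHistoryBlind`),
admissibility transported (read through `toStage13Params`), `RecordS` stated LITERALLY (skeleton-local; presenting parameter the quadruply pinned H-parameter), N12's `h12` by the mixed pin through 12E's proviso-free ★★ row (`(⟨⟨Θ.liveRepin₁₃, Zr⟩, Zh,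
Phih⟩).toStage13Params = Θ.liveRepin₁₃`, `rfl`; N12 READS NO 𝐓-WEIGHT — `WOfRecord₁₃` ∕ `reprTOfRecord₁₃` ∕ `gOfRecord₁₃` are NOT re-issued at v1.7), **N13's (R₁₃CoPH) row by dag-n11-e's v1.7 `laws₁₃CoPH_liveRepin₁₃_of_hasResiduals`**
(`B16RLeafRecord13LiveCoPH` §Repin: at the H-extension with all three slots free — both laws read `θ.rzAt P` ∕ `WtOfRecord₁₃H θ P` PER HISTORY, FILE 27 SITE RULE S₇; admissibility + the three term-constant signs; at the door-cured pin the same row, the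
pin BEING such an extension by `rfl`), N08 the displayed `h08`, the v5 pin at `λ := lamW` from `hsel` + `hW` + `hup`.  WHICH CHILD BLOCKS = the hypothesis list, nothing hidden: the K1-side `hP : Provisos₁₃SepCoPH` at the extension (at the door-cured pin:
K1⁵'s `Provisos₁₃SepCoP` lifted by `.ofCured.ofHistoryBlind`), `hZh` (generic slots only), the world binding `hC hγ hL hup`, `h05S`, rows h06–h10, `h11` (S1ᵀ)₁₃CoPH (director-ym №183 ∕ №186: at k ≥ 1 its VALUE is a first-hand [IV]-body question —
displayed, never asserted), `hUV`, `hsel`, `hWdeg` (fires only at `K = 0` under `hsel`), N12's per-run displays BELOW THE TORUS ONLY ((1.100) pin, live-mass — NODE 00 —, Prop. 1 — dag-n12-c via 12Q′ —, (1.80), (1.89) — dag-n12-e's pins), the three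
term-constant signs.  At `N := 2` the ★★ conclusion IS `NodesAtSomeRecord13PWS F`'s v5 body with `RecordS` unfolded (certificate `HOME/lean/g12/ScratchShape12TH.lean` rc 0, both directions by `exact`, skeleton texts copied verbatim from the plan's
dry-run).  ONE-WAY (FILE 27 §H1): the door-cured pin is history-BLIND — the image of the K0⁶ → K0⁷ witness road (bridge ⁷ ⇐ ⁶), not print's history-reading weights; §1 is the socket for those.  Nothing of Bałaban's is asserted; N12 is NOT discharged; no
node is discharged; counts unmoved (Track A discharged 5∕28); a re-key is not progress.  ONE finite four-torus programme at fixed `ε = L^{-K}` — nothing continuum ∕ ℝ⁴ ∕ OS ∕ mass gap ∕ Clay.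
-/

noncomputable section
open MeasureTheory
open scoped Matrix.Norms.L2Operator
namespace Summit.QuantumFields.YangMills.BalabanUVNodes.N12AtRecord13SepCoPHSockets
open Literature.MathematicalPhysics.QuantumFieldTheory.Balaban1983to89
open Literature.MathematicalPhysics.QuantumFieldTheory.Balaban1983to89.T4Continuum (T4Family)
open Literature.MathematicalPhysics.QuantumFieldTheory.Balaban1983to89.DagBinding
open Literature.MathematicalPhysics.QuantumFieldTheory.Balaban1983to89.Node00
open FlowStep (BetaLowerH BetaUpperH)
open FlowStepRuns (genFlow)
open B15Claim189Assembly (new189 chiPP dom)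
open B15 (Prop1Printed Ineq180)
open B15.BasicStep (Claim189)
open B8Eq17ClassAkV1 (plaqsOf)
open B15RPrime1100OfRep (rPrimeDataOfSel)
open B14NodeKnitRecord9 (b14_main_at_construction_rhoOfRecord9_along)
open B16NodeKnitRepTowerOfRecord (b16_main_at_repTowerOfRecord_along)
open B16RLeafRecord13LiveCoPH (laws₁₃CoPH_liveRepin₁₃_of_hasResiduals)
open Summit.QuantumFields.YangMills.BalabanUVNodes.N12AtRecord13OfResiduals (b15Leaf_WOfRecord₁₃_liveRepin₁₃_of_massLive_of_hasResiduals)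
open Summit.QuantumFields.YangMills.BalabanUVNodes.N12AtTheta13OfThm1CC1 (kappa_nonneg_theta13OfThm1CC1 E0_nonneg_theta13OfThm1CC1 B0_nonneg_theta13OfThm1CC1)

variable {N : ℕ} [NeZero N] {F : T4Family}

/-! ## §0 THE S-BOUND GENERIC-`W₀` FOUR-PIN ENGINE AT v1.7 (generic `θ : Stage13HParams`; dag-n24-c's C-bound W₀ engine carried to the S-binding by their own transport) -/
section Engine
variable (θ : Stage13HParams F N) (Mstar : ℕ) (ops : OpsY N θ.toStage3Params Mstar) (ζ : ResidZ F N) (W₀ : B12.RunParams → PrintedCarriers15) (w : WorldP)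

/-- **THE C-BOUND TWIN WORLD OF THE S-BOUND GENERIC-`W₀` FOUR-PIN WORLD IS A v1.7 CORE RECORD AT THE SAME DATUM** (`{ w with up := upOfRecord₅C (four-pin view) }`; presenting parameter the quadruply pinned H-parameter — dag-n10-d's H-pins (W1) with their
CORE proviso faces, the datum pins `rfl`, the view identities `toStage5₁₃CoPH_pin*`; = the T₇ image of dag-n24-c's `N24_isRecordOfRecord₁₃CCoPR_of_up_pinB10YZW₀` (5R) at the twin). N01–N04 transfer from it (none reads `b8`). [cite: Balaban1989LargeFieldII, Thm 1 + (0.1) pp.355–356; Balaban1985UV3, Thm 1 p.257; Balaban1985BackgroundPropagators, Thm 3.1 p.397; Balaban1985Variational, Thm 1 p.279; Balaban1989LargeFieldI, (0.2) p.176 (bookkeeping)] -/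
theorem record₁₃CCoPH_twin_of_upS_pinB10YZW₀ (h : θ.Provisos₁₃CoPH F N) (hθ : θ.Admissible F N)
    (hC : w.C = (datumOfRecord₁₃CoPH F N θ h).C) (hγ : 0 < w.γ ∧ w.γ ≤ θ.γ) (hL : w.L = (θ.L : ℝ)) :
    IsRecordOfRecord₁₃CCoPH F N (datumOfRecord₁₃CoPH F N θ h) { w with up := fun P => upOfRecord₅C F N (((((θ.toStage5₁₃CoPH F N).pinB10 F N).pinY F N (Y9OfRecord N θ.toStage3Params Mstar ops)).pinZ F N (Z11OfRecord F N ζ)).pinW F N W₀) P } := by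
  refine ⟨((((θ.pinB10 F N).pinY F N (Y9OfRecord N θ.toStage3Params Mstar ops)).pinZ F N (Z11OfRecord F N ζ)).pinW F N W₀), ((h.pinB10.pinY (Y9OfRecord N θ.toStage3Params Mstar ops)).pinZ (Z11OfRecord F N ζ)).pinW W₀,
    (Stage13Params.pinW_admissible_iff F N _ _).2 ((Stage13Params.pinZ_admissible_iff F N _ _).2
      ((Stage13Params.pinY_admissible_iff F N _ _).2 ((Stage13Params.pinB10_admissible_iff F N θ.toStage13Params).2 hθ))), ?_, hC, hγ, hL, fun P => ?_⟩
  · exact ((datumOfRecord₁₃CoPH_pinB10 F N θ h).symm.trans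
      ((datumOfRecord₁₃CoPH_pinY F N (θ.pinB10 F N) h.pinB10 (Y9OfRecord N θ.toStage3Params Mstar ops)).symm.trans
        ((datumOfRecord₁₃CoPH_pinZ F N _ (h.pinB10.pinY (Y9OfRecord N θ.toStage3Params Mstar ops)) (Z11OfRecord F N ζ)).symm.trans
          (datumOfRecord₁₃CoPH_pinW F N _ ((h.pinB10.pinY (Y9OfRecord N θ.toStage3Params Mstar ops)).pinZ (Z11OfRecord F N ζ)) W₀).symm)))
  · show upOfRecord₅C F N (((((θ.toStage5₁₃CoPH F N).pinB10 F N).pinY F N (Y9OfRecord N θ.toStage3Params Mstar ops)).pinZ F N (Z11OfRecord F N ζ)).pinW F N W₀) P = _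
    rw [Stage13HParams.toStage5₁₃CoPH_pinW, Stage13HParams.toStage5₁₃CoPH_pinZ, Stage13HParams.toStage5₁₃CoPH_pinY, Stage13HParams.toStage5₁₃CoPH_pinB10]

/-- **A WORLD S-BOUND TO THE GENERIC-`W₀` FOUR-PIN VIEW IS IN `RecordS F θ h w`** (plan's skeleton-local class stated LITERALLY at general `N`; presenting parameter the quadruply pinned H-parameter with its v1.4-range provisos `((h.pinB10.pinY _).pinZ
_).pinW W₀` — dag-n10-d W2 `Record13CarriersSepCoPH` —, SAME datum (`datumOfRecord₁₃SepCoPH_pin*`, `rfl`), the S-binding over its view). [cite: Balaban1989LargeFieldII, Thm 1 + (0.1) pp.355–356; Balaban1985RegularSpaces, Thm 8 p.101 (surviving form; bookkeeping)] -/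
theorem recordS₁₃SepCoPH_of_upS_pinB10YZW₀ (h : θ.Provisos₁₃SepCoPH F N) (hθ : θ.Admissible F N)
    (hC : w.C = (datumOfRecord₁₃SepCoPH F N θ h).C) (hγ : 0 < w.γ ∧ w.γ ≤ θ.γ) (hL : w.L = (θ.L : ℝ))
    (hup : ∀ P, w.up P = upOfRecord₅CS F N (((((θ.toStage5₁₃CoPH F N).pinB10 F N).pinY F N (Y9OfRecord N θ.toStage3Params Mstar ops)).pinZ F N (Z11OfRecord F N ζ)).pinW F N W₀) P) :
    (∃ (θ'' : Stage13HParams F N) (h'' : θ''.Provisos₁₃SepCoPH F N), θ''.Admissible F N ∧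
      datumOfRecord₁₃SepCoPH F N θ h = datumOfRecord₁₃SepCoPH F N θ'' h'' ∧ w.C = (datumOfRecord₁₃SepCoPH F N θ h).C ∧ (0 < w.γ ∧ w.γ ≤ θ''.γ) ∧
      w.L = (θ''.L : ℝ) ∧ ∀ P : B12.RunParams, w.up P = upOfRecord₅CS F N (θ''.toStage5₁₃CoPH F N) P) := by
  refine ⟨((((θ.pinB10 F N).pinY F N (Y9OfRecord N θ.toStage3Params Mstar ops)).pinZ F N (Z11OfRecord F N ζ)).pinW F N W₀), ((h.pinB10.pinY (Y9OfRecord N θ.toStage3Params Mstar ops)).pinZ (Z11OfRecord F N ζ)).pinW W₀,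
    (Stage13Params.pinW_admissible_iff F N _ _).2 ((Stage13Params.pinZ_admissible_iff F N _ _).2
      ((Stage13Params.pinY_admissible_iff F N _ _).2 ((Stage13Params.pinB10_admissible_iff F N θ.toStage13Params).2 hθ))), ?_, hC, hγ, hL, fun P => ?_⟩
  · exact ((datumOfRecord₁₃SepCoPH_pinB10 F N θ h).symm.trans
      ((datumOfRecord₁₃SepCoPH_pinY F N (θ.pinB10 F N) h.pinB10 (Y9OfRecord N θ.toStage3Params Mstar ops)).symm.trans
        ((datumOfRecord₁₃SepCoPH_pinZ F N _ (h.pinB10.pinY (Y9OfRecord N θ.toStage3Params Mstar ops)) (Z11OfRecord F N ζ)).symm.trans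
          (datumOfRecord₁₃SepCoPH_pinW F N _ ((h.pinB10.pinY (Y9OfRecord N θ.toStage3Params Mstar ops)).pinZ (Z11OfRecord F N ζ)) W₀).symm)))
  · rw [hup P, Stage13HParams.toStage5₁₃CoPH_pinW, Stage13HParams.toStage5₁₃CoPH_pinZ, Stage13HParams.toStage5₁₃CoPH_pinY, Stage13HParams.toStage5₁₃CoPH_pinB10]

/-- **The pins and the S-binding never touch the 𝐑-carrier**: at a world S-bound to the generic-`W₀` four-pin view, `(leavesP w P).rOperation ↔ ∀ k < K, TLaw₁₃CoPH θ P k → SLaw₁₃CoPH θ P (k+1)` (`withB8` keeps `rOperation`; `Iff.rfl` to `ROpLeaf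
(VOfRecord₁₃CoPH θ P)`, node00-def-T's `rOpLeaf_VOfRecord₁₃CoPH_iff`). [cite: Balaban1989LargeFieldII, Thm 1 p.355; Balaban1988Convergent, p.244 and Thm 2 p.263 (bookkeeping: the leaf unfolded)] -/
theorem rOperation_iff_of_upS_pinB10YZW₀ {P : B12.RunParams} (hup : w.up P = upOfRecord₅CS F N (((((θ.toStage5₁₃CoPH F N).pinB10 F N).pinY F N (Y9OfRecord N θ.toStage3Params Mstar ops)).pinZ F N (Z11OfRecord F N ζ)).pinW F N W₀) P) :
    (leavesP w P).rOperation ↔ ∀ k, k < P.K → TLaw₁₃CoPH F N θ P k → SLaw₁₃CoPH F N θ P (k + 1) := by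
  have hV : (leavesP w P).rOperation ↔ ROpLeaf (VOfRecord₁₃CoPH F N θ P) := by
    show (w.up P).rOperation ↔ _
    rw [hup]
    exact Iff.rfl
  exact hV.trans (rOpLeaf_VOfRecord₁₃CoPH_iff F N θ P)

/-- **★ N24's THIRTEEN DAG NODES AT A WORLD S-BOUND TO THE GENERIC-`W₀` FOUR-PIN VIEW OF A v1.7 PARAMETER** (Core-keyed; dag-n24-c's `N24_nodes₁₃B10YZW₀_pointed_coP(R)` carried to the S-binding by their p529950 transport): **N05 ← the SURVIVING `b8` leaf
of that S-binding** (`h05S`, displayed at the view); N06 `B9LeafX (Y9OfRecord …)`; N07 `B11Leaf (Z11OfRecord F N ζ)`; **N08 `PrintedUV3V N θ.L`**; N09 own leaf at `θ.res.X P` + Theorem-3 member `h09T`; N10 B13 socket at the view (at the C-bound twin;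
`Dag.B13_main` reads `b9 b10 b11 b12 b13` only); N11 (S1ᵀ)₁₃CoPH `h11`; **N12 `B15Leaf (W₀ P)` at a FREE [IV] carrier family**; N13 (R₁₃CoPH) `hR` + (UV₁₃) `hUV`; N01 ∕ N02 ∕ N04 node00-def-T's transferred `CoPH` theorems and N03 node00-def-T's
`atWorld_of_isRecordOfRecord₁₃CCoPH` over dag-n24-c's Stage-5 `N03_at_record₅C` at the C-bound twin, transported by `leavesP_eq_of_up_withB8`. [cite: Balaban1989LargeFieldII, Thm 1 p.355, (0.1) pp.355–356, p.387, p.391; Balaban1989LargeFieldI, (0.1) p.175, (0.2)–(0.6) p.176, p.177 (i)–(ii), Prop. 1 (1.78) p.194, (1.80) p.195, (1.89) p.198, (1.99)–(1.102) pp.200–201; Balaban1988Convergent, (1.11) p.248, p.244, Thm 1 p.262, (2.18) p.257, (3.16)–(3.25) pp.268–270; Balaban1985RegularSpaces, Lemma 1 – Thm 8 pp.79–101, Thm 8 (1.146) p.101 (surviving form); Balaban1985UV3, Thm 1 p.257, Thm 2 p.272; Balaban1985BackgroundPropagators, Thm 3.1 p.397; Balaban1985Variational, Thm 1 p.279; Balaban1987RG1,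 Thm 1 p.259, Lemma 4 p.280; Balaban1988RG2Cluster, Lemmas 1–3 pp.9–20 (bookkeeping)] -/
theorem nodes₁₃CoPH_upS_fourPinW₀_pointed (h : θ.Provisos₁₃CoPH F N) (hθ : θ.Admissible F N)
    (hC : w.C = (datumOfRecord₁₃CoPH F N θ h).C) (hγ : 0 < w.γ ∧ w.γ ≤ θ.γ) (hL : w.L = (θ.L : ℝ))
    (hup : ∀ P, w.up P = upOfRecord₅CS F N (((((θ.toStage5₁₃CoPH F N).pinB10 F N).pinY F N (Y9OfRecord N θ.toStage3Params Mstar ops)).pinZ F N (Z11OfRecord F N ζ)).pinW F N W₀) P)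
    (h05S : ∀ P : B12.RunParams, (upOfRecord₅CS F N (((((θ.toStage5₁₃CoPH F N).pinB10 F N).pinY F N (Y9OfRecord N θ.toStage3Params Mstar ops)).pinZ F N (Z11OfRecord F N ζ)).pinW F N W₀) P).b8)
    (h06 : B9LeafX (Y9OfRecord N θ.toStage13Params.toStage3Params Mstar ops))
    (h07 : B11Leaf (Z11OfRecord F N ζ))
    (h08 : PrintedUV3V N θ.toStage13Params.L)
    (h09 : ∀ P : B12.RunParams, B12Sec2to5.Lemma4Printed (θ.toStage13Params.res.X P).F12 (θ.toStage13Params.res.X P).c12)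
    (h09T : ∀ P : B12.RunParams, (leavesP w P).smallCouplings → (leavesP w P).smallFieldInductive)
    (h10 : ∀ P : B12.RunParams, B9LeafX (Y9OfRecord N θ.toStage13Params.toStage3Params Mstar ops) →
      (B10.Thm1PrintedCompact ((((((θ.toStage5₁₃CoPH F N).pinB10 F N).pinY F N (Y9OfRecord N θ.toStage13Params.toStage3Params Mstar ops)).pinZ F N (Z11OfRecord F N ζ)).pinW F N W₀).res.X P).runs10 ∧
          B10.Thm2Printed ((((((θ.toStage5₁₃CoPH F N).pinB10 F N).pinY F N (Y9OfRecord N θ.toStage13Params.toStage3Params Mstar ops)).pinZ F N (Z11OfRecord F N ζ)).pinW F N W₀).res.X P).runs10) →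
        B11Leaf (Z11OfRecord F N ζ) → B12Sec2to5.Lemma4Printed (θ.toStage13Params.res.X P).F12 (θ.toStage13Params.res.X P).c12 →
          B13.Lemma1Printed (θ.toStage13Params.res.X P).S13 (θ.toStage13Params.res.X P).c13 ∧ B13.Lemma2Printed (θ.toStage13Params.res.X P).S13 (θ.toStage13Params.res.X P).c13 ∧
            B13.Lemma3Printed (θ.toStage13Params.res.X P).S13 (θ.toStage13Params.res.X P).c13)
    (h11 : ∀ P : B12.RunParams, (leavesP w P).b7 → (leavesP w P).b8 → (leavesP w P).b9 → (leavesP w P).b10 → (leavesP w P).b11 →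
      (leavesP w P).smallCouplings → (leavesP w P).smallFieldInductive → (leavesP w P).flowControl →
        ∀ k, k < P.K → SLaw₁₃CoPH F N θ P k → TLaw₁₃CoPH F N θ P k)
    (h12 : ∀ P : B12.RunParams, B15Leaf (W₀ P))
    (hR : ∀ (P : B12.RunParams) (k : ℕ), k < P.K → TLaw₁₃CoPH F N θ P k → SLaw₁₃CoPH F N θ P (k + 1))
    (hUV : ∀ P : B12.RunParams, (genFlow (betaOfRecord₁₃ F N θ.toStage13Params) P.g0).InInterval w.γ P.K → ∀ k, k ≤ P.K → SLaw₁₃CoPH F N θ P k →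
      ∀ U : GaugeField (F.P P.K) k (SU N),
        chiβOfRecord₁₃ F N θ.toStage13Params P.K (gOfRecord₁₃ F N θ.toStage13Params P) k U *
              Real.exp (-(1 / (gOfRecord₁₃ F N θ.toStage13Params P k) ^ 2 * wilsonBGOfRecord F N θ.toStage13Params.εbg P k U)
                - w.em (gOfRecord₁₃ F N θ.toStage13Params P k) * (Fintype.card (Site (F.P P.K) k) : ℝ)) ≤ densOfRecord₁₃ F N θ.toStage13Params P k U ∧
        densOfRecord₁₃ F N θ.toStage13Params P k U ≤ Real.exp (w.ep (gOfRecord₁₃ F N θ.toStage13Params P k) * (Fintype.card (Site (F.P P.K) k) : ℝ))) :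
    ∀ P : B12.RunParams, Nodes (leavesP w P) := by
  intro P
  have hrec' := record₁₃CCoPH_twin_of_upS_pinB10YZW₀ θ Mstar ops ζ W₀ w h hθ hC hγ hL
  have hw8 : ∀ P, w.up P = (upOfRecord₅C F N (((((θ.toStage5₁₃CoPH F N).pinB10 F N).pinY F N (Y9OfRecord N θ.toStage3Params Mstar ops)).pinZ F N (Z11OfRecord F N ζ)).pinW F N W₀) P).withB8 (leavesP w P).b8 := fun P => by
    show w.up P = (upOfRecord₅C F N _ P).withB8 (w.up P).b8
    rw [hup P]
    exact upOfRecord₅CS_eq_withB8 F N _ P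
  have hleaves := leavesP_eq_of_up_withB8 hw8 P
  have h4 : Dag.B4_main (leavesP w P) := by rw [hleaves]; exact b4_main_of_isRecordOfRecord₁₃CCoPH hrec' P
  have h5 : Dag.B5_main (leavesP w P) := by rw [hleaves]; exact b5_main_of_isRecordOfRecord₁₃CCoPH hrec' P
  have h6 : Dag.B6_main (leavesP w P) := by rw [hleaves]; exact atWorld_of_isRecordOfRecord₁₃CCoPH (fun _ _ h5 P => N03_at_record₅C h5 P) hrec' P
  have h7 : Dag.B7_main (leavesP w P) := by rw [hleaves]; exact b7_main_of_isRecordOfRecord₁₃CCoPH hrec' P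
  have hw := upOfRecord₅C_pinW_b9_b10_b11 F N (((((θ.toStage5₁₃CoPH F N).pinB10 F N).pinY F N (Y9OfRecord N θ.toStage3Params Mstar ops)).pinZ F N (Z11OfRecord F N ζ))) W₀ P
  have hl : ((upOfRecord₅C F N (((((θ.toStage5₁₃CoPH F N).pinB10 F N).pinY F N (Y9OfRecord N θ.toStage3Params Mstar ops)).pinZ F N (Z11OfRecord F N ζ)).pinW F N W₀) P).rBasicStep ↔ B15Leaf (W₀ P)) ∧
      ((upOfRecord₅C F N (((((θ.toStage5₁₃CoPH F N).pinB10 F N).pinY F N (Y9OfRecord N θ.toStage3Params Mstar ops)).pinZ F N (Z11OfRecord F N ζ)).pinW F N W₀) P).b9 ↔ B9LeafX (Y9OfRecord N θ.toStage3Params Mstar ops)) ∧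
      ((upOfRecord₅C F N (((((θ.toStage5₁₃CoPH F N).pinB10 F N).pinY F N (Y9OfRecord N θ.toStage3Params Mstar ops)).pinZ F N (Z11OfRecord F N ζ)).pinW F N W₀) P).b10 ↔ PrintedUV3V N θ.L) ∧
      ((upOfRecord₅C F N (((((θ.toStage5₁₃CoPH F N).pinB10 F N).pinY F N (Y9OfRecord N θ.toStage3Params Mstar ops)).pinZ F N (Z11OfRecord F N ζ)).pinW F N W₀) P).b11 ↔ B11Leaf (Z11OfRecord F N ζ)) := by
    refine ⟨upOfRecord₅C_pinW_rBasicStep_iff F N _ _ P, ?_, ?_, ?_⟩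
    · rw [hw.1, upOfRecord₅C_pinZ_b9]
      exact upOfRecord₅C_pinY_b9_iff F N _ _ P
    · rw [hw.2.1, upOfRecord₅C_pinZ_b10, upOfRecord₅C_pinY_b10]
      exact upOfRecord₅C_pinB10_b10_iff F N (θ.toStage5₁₃CoPH F N) P
    · rw [hw.2.2]
      exact upOfRecord₅C_pinZ_b11_iff F N _ _ P
  have h8 : (w.up P).b8 := by rw [hup P]; exact h05S P
  have h9 : (w.up P).b9 := by rw [hup P]; exact hl.2.1.2 h06
  have h10leaf : (w.up P).b10 := by rw [hup P]; exact hl.2.2.1.2 h08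
  have h11leaf : (w.up P).b11 := by rw [hup P]; exact hl.2.2.2.2 h07
  have h15 : (w.up P).rBasicStep := by rw [hup P]; exact hl.1.2 (h12 P)
  have h12leaf : (leavesP w P).b12 := by
    show (w.up P).b12
    rw [hup P]; exact h09 P
  have h13 : Dag.B13_main (leavesP w P) := by
    have h' : Dag.B13_main (leavesP { w with up := fun P => upOfRecord₅C F N (((((θ.toStage5₁₃CoPH F N).pinB10 F N).pinY F N (Y9OfRecord N θ.toStage3Params Mstar ops)).pinZ F N (Z11OfRecord F N ζ)).pinW F N W₀) P } P) :=
      B13NodeKnitRecord5C.b13_main_at_stage5ParamsC F N (((((θ.toStage5₁₃CoPH F N).pinB10 F N).pinY F N (Y9OfRecord N θ.toStage3Params Mstar ops)).pinZ F N (Z11OfRecord F N ζ)).pinW F N W₀) _ P rfl (h10 P)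
    show (w.up P).b9 → (w.up P).b10 → (w.up P).b11 → (w.up P).b12 → (w.up P).b13
    rw [hup P]
    exact h'
  have hrop := rOperation_iff_of_upS_pinB10YZW₀ θ Mstar ops ζ W₀ w (hup P)
  exact ⟨h4, h5, h6, h7, B8LeafKnit.b8_main_of_leaf w P h8, fun _ _ _ _ => h9, fun _ _ _ _ _ _ => h10leaf,
    fun _ _ _ _ _ => h11leaf, B12NodeKnitRecord8.b12_main_of_leaf_of_thm3Member h12leaf (h09T P), h13,
    b14_main_at_construction_rhoOfRecord9_along F N (coreOfRecord₁₃CoPH F N θ) w P θ.ν θ.τ9 (EOfRecord₁₃ F N θ.toStage13Params) (wOfRecord₉ F N θ.toStage9Params) θ.ppSel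
      (gOfRecord₁₃ F N θ.toStage13Params) (fun p k _ => SLaw₁₃CoPH F N θ p k) (fun p k _ => TLaw₁₃CoPH F N θ p k) (hC.trans (datumOfRecord₁₃CoPH_C F N θ h))
      (fun _ _ => Iff.rfl) (fun _ => sLaw₁₃CoPH_zero F N θ P) (h11 P) (fun hr => hrop.1 hr),
    B15LeafKnit.b15_main_of_up (U := w.up P) rfl h15,
    b16_main_at_repTowerOfRecord_along F N (coreOfRecord₁₃CoPH F N θ) w P θ.ν θ.τ9 (EOfRecord₁₃ F N θ.toStage13Params) (wOfRecord₉ F N θ.toStage9Params) θ.ppSel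
      (gOfRecord₁₃ F N θ.toStage13Params) (fun k _ => SLaw₁₃CoPH F N θ P k) (fun k _ => TLaw₁₃CoPH F N θ P k) (hC.trans (datumOfRecord₁₃CoPH_C F N θ h))
      (fun _ _ => Iff.rfl) hrop.2 (hR P) le_rfl (hUV P)⟩
end Engine

/-! ## §1 ★★ THE v5 RUNG BODY AT THE H-EXTENSION `⟨⟨Θ.liveRepin₁₃, Zr⟩, Zh, Phih⟩` OF THE LIVE RE-PIN OF A `Θ` CARRYING K0b's RESIDUALS (all three slots free: `hZh` displayed), N12 AND N13 RESOLVED -/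
section Live
variable (Θ : Stage13Params F N) (Zr : (q : B12.RunParams) → TkResidualW F N (FluctV N) q.K)
  (Zh : (q : B12.RunParams) → ℕ → (ℕ → Set (Site (F.P q.K) 0)) → (ℕ → Set (Site (F.P q.K) 0)) → TkResidualW F N (FluctV N) q.K)
  (Phih : (q : B12.RunParams) → ℕ → (ℕ → Set (Site (F.P q.K) 0)) → (ℕ → Set (Site (F.P q.K) 0)) → (ℕ → Plaq (F.P q.K) 0 → ℝ)) (lamW : ResidW F N)
  (Mstar : ℕ) (ops : OpsY N (Θ.liveRepin₁₃ F N).toStage3Params Mstar) (ζ : ResidZ F N) (W₀ : B12.RunParams → PrintedCarriers15) (w : WorldP)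

/-- **★★ THE BODY OF THE K1⁷ RUNG v5 `NodesAtSomeRecord13PWS` (= the registered v4 under T₇) OVER THE S-BOUND GENERIC-`W₀` FOUR-PIN VIEW OF THE H-EXTENSION OF THE LIVE RE-PIN, N12 AND N13 RESOLVED** — witnesses `(⟨⟨Θ.liveRepin₁₃, Zr⟩, Zh, Phih⟩, hP, w)`
and `λ := lamW`: guard ⟸ `hZh` (displayed; a theorem at the door-cured pin, §2) + K0a FILE 9 v1.1 `slotsNondegenerate₁₃_liveRepin_of_hasResiduals`; admissibility transported (`hθ.liveRepin₁₃`); `RecordS` by §0; `Nodes` by §0's engine with **N12's `h12`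
BY THE MIXED W-PIN** — below the torus (`λ.kSel P < P.K`) `W₀ P = WOfRecord₁₃ F N (Θ.liveRepin₁₃ F N) λ P` (`hW`) and 12E's ★★ row from the per-run displays `h12pin ∕ h12mass ∕ h12P1 ∕ h12i180 ∕ h12c189`, elsewhere (`K = 0` under `hsel`) the closer's
leaf-carrying `W₀ P` (`hWdeg`; e.g. the degenerate carrier of g4 `exists_printedCarriers15_b15Leaf`) — and **N13's (R₁₃CoPH) row by dag-n11-e's v1.7 `laws₁₃CoPH_liveRepin₁₃_of_hasResiduals`** (`B16RLeafRecord13LiveCoPH` §Repin, p540794: at the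
H-extension with ALL THREE SLOTS FREE — both laws read `θ.rzAt P` ∕ `WtOfRecord₁₃H θ P` per history, FILE 27 SITE RULE S₇; admissibility + the three term-constant signs); `PrintedUV3V` the displayed `h08`; the v5 pin at `λ := lamW` from `hsel` + `hW` +
`hup`.  At `N := 2` the conclusion is `stub_nodes13PWS`'s consequent with `RecordS` unfolded.  COMPOSITE: nothing is discharged as a node. [cite: Balaban1989LargeFieldII, Thm 1 p.355, (0.1) pp.355–356, p.387, p.391; Balaban1989LargeFieldI, (0.1) p.175, (0.2)–(0.6) p.176, p.177 (i)–(ii), Prop. 1 (1.78) p.194, (1.80) p.195, (1.89) p.198, (1.99)–(1.102) pp.200–201; Balaban1988Convergent, (1.11) p.248, p.244, Thm 1 p.262, (2.18) p.257, (3.16)–(3.25) pp.268–270; Balaban1985RegularSpaces, Lemma 1 – Thm 8 pp.79–101, Thm 8 (1.146) p.101 (surviving form); Balaban1985UV3, Thm 1 p.257, Thm 2 p.272; Balaban1985BackgroundPropagators, Thm 3.1 p.397; Balaban1985Variational, Thm 1 p.279; Balaban1987RG1, Thm 1 p.259, Lemma 4 p.280; Balaban1988RG2Cluster, Lemmas 1–3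 pp.9–20 (bookkeeping)] -/
theorem nodesAtSomeRecordS₁₃SepCoPH_of_upS_fourPinW₀_liveRepin₁₃H_of_massLive_of_hasResiduals (hres : Θ.HasResidualsOfRecord F N)
    (hP : (⟨⟨Θ.liveRepin₁₃ F N, Zr⟩, Zh, Phih⟩ : Stage13HParams F N).Provisos₁₃SepCoPH F N) (hθ : Θ.Admissible F N) (hZh : (⟨⟨Θ.liveRepin₁₃ F N, Zr⟩, Zh, Phih⟩ : Stage13HParams F N).ZhUnity F N)
    (hκ : 0 ≤ Θ.s2.lf.κ) (hE₀ : 0 ≤ Θ.s2.lf.E₀) (hB₀ : 0 ≤ Θ.s2.lf.B₀)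
    -- the mixed W-pin: the generic [IV] carrier family AGREES WITH THE BUNDLE OF RECORD on the runs whose selected step is a printed step, and carries the leaf elsewhere
    (hW : ∀ P : B12.RunParams, lamW.kSel P < P.K → W₀ P = WOfRecord₁₃ F N (Θ.liveRepin₁₃ F N) lamW P) (hWdeg : ∀ P : B12.RunParams, P.K ≤ lamW.kSel P → B15Leaf (W₀ P))
    (hC : w.C = (datumOfRecord₁₃SepCoPH F N (⟨⟨Θ.liveRepin₁₃ F N, Zr⟩, Zh, Phih⟩ : Stage13HParams F N) hP).C) (hγ : 0 < w.γ ∧ w.γ ≤ (Θ.liveRepin₁₃ F N).γ) (hL : w.L = ((Θ.liveRepin₁₃ F N).L : ℝ))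
    (hup : ∀ P, w.up P = upOfRecord₅CS F N ((((((⟨⟨Θ.liveRepin₁₃ F N, Zr⟩, Zh, Phih⟩ : Stage13HParams F N).toStage5₁₃CoPH F N).pinB10 F N).pinY F N (Y9OfRecord N (Θ.liveRepin₁₃ F N).toStage3Params Mstar ops)).pinZ F N (Z11OfRecord F N ζ)).pinW F N W₀) P)
    (h05S : ∀ P : B12.RunParams, (upOfRecord₅CS F N ((((((⟨⟨Θ.liveRepin₁₃ F N, Zr⟩, Zh, Phih⟩ : Stage13HParams F N).toStage5₁₃CoPH F N).pinB10 F N).pinY F N (Y9OfRecord N (Θ.liveRepin₁₃ F N).toStage3Params Mstar ops)).pinZ F N (Z11OfRecord F N ζ)).pinW F N W₀) P).b8)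
    (h06 : B9LeafX (Y9OfRecord N (Θ.liveRepin₁₃ F N).toStage3Params Mstar ops))
    (h07 : B11Leaf (Z11OfRecord F N ζ))
    (h08 : PrintedUV3V N (Θ.liveRepin₁₃ F N).L)
    (h09 : ∀ P : B12.RunParams, B12Sec2to5.Lemma4Printed ((Θ.liveRepin₁₃ F N).res.X P).F12 ((Θ.liveRepin₁₃ F N).res.X P).c12)
    (h09T : ∀ P : B12.RunParams, (leavesP w P).smallCouplings → (leavesP w P).smallFieldInductive)
    (h10 : ∀ P : B12.RunParams, B9LeafX (Y9OfRecord N (Θ.liveRepin₁₃ F N).toStage3Params Mstar ops) →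
      (B10.Thm1PrintedCompact (((((((⟨⟨Θ.liveRepin₁₃ F N, Zr⟩, Zh, Phih⟩ : Stage13HParams F N).toStage5₁₃CoPH F N).pinB10 F N).pinY F N (Y9OfRecord N (Θ.liveRepin₁₃ F N).toStage3Params Mstar ops)).pinZ F N (Z11OfRecord F N ζ)).pinW F N W₀).res.X P).runs10 ∧
          B10.Thm2Printed (((((((⟨⟨Θ.liveRepin₁₃ F N, Zr⟩, Zh, Phih⟩ : Stage13HParams F N).toStage5₁₃CoPH F N).pinB10 F N).pinY F N (Y9OfRecord N (Θ.liveRepin₁₃ F N).toStage3Params Mstar ops)).pinZ F N (Z11OfRecord F N ζ)).pinW F N W₀).res.X P).runs10) →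
        B11Leaf (Z11OfRecord F N ζ) → B12Sec2to5.Lemma4Printed ((Θ.liveRepin₁₃ F N).res.X P).F12 ((Θ.liveRepin₁₃ F N).res.X P).c12 →
          B13.Lemma1Printed ((Θ.liveRepin₁₃ F N).res.X P).S13 ((Θ.liveRepin₁₃ F N).res.X P).c13 ∧ B13.Lemma2Printed ((Θ.liveRepin₁₃ F N).res.X P).S13 ((Θ.liveRepin₁₃ F N).res.X P).c13 ∧
            B13.Lemma3Printed ((Θ.liveRepin₁₃ F N).res.X P).S13 ((Θ.liveRepin₁₃ F N).res.X P).c13)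
    (h11 : ∀ P : B12.RunParams, (leavesP w P).b7 → (leavesP w P).b8 → (leavesP w P).b9 → (leavesP w P).b10 → (leavesP w P).b11 →
      (leavesP w P).smallCouplings → (leavesP w P).smallFieldInductive → (leavesP w P).flowControl →
        ∀ k, k < P.K → SLaw₁₃CoPH F N (⟨⟨Θ.liveRepin₁₃ F N, Zr⟩, Zh, Phih⟩ : Stage13HParams F N) P k → TLaw₁₃CoPH F N (⟨⟨Θ.liveRepin₁₃ F N, Zr⟩, Zh, Phih⟩ : Stage13HParams F N) P k)
    (hUV : ∀ P : B12.RunParams, (genFlow (betaOfRecord₁₃ F N (Θ.liveRepin₁₃ F N)) P.g0).InInterval w.γ P.K → ∀ k, k ≤ P.K → SLaw₁₃CoPH F N (⟨⟨Θ.liveRepin₁₃ F N, Zr⟩, Zh, Phih⟩ : Stage13HParams F N) P k →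
      ∀ U : GaugeField (F.P P.K) k (SU N),
        chiβOfRecord₁₃ F N (Θ.liveRepin₁₃ F N) P.K (gOfRecord₁₃ F N (Θ.liveRepin₁₃ F N) P) k U *
              Real.exp (-(1 / (gOfRecord₁₃ F N (Θ.liveRepin₁₃ F N) P k) ^ 2 * wilsonBGOfRecord F N (Θ.liveRepin₁₃ F N).εbg P k U)
                - w.em (gOfRecord₁₃ F N (Θ.liveRepin₁₃ F N) P k) * (Fintype.card (Site (F.P P.K) k) : ℝ)) ≤ densOfRecord₁₃ F N (Θ.liveRepin₁₃ F N) P k U ∧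
        densOfRecord₁₃ F N (Θ.liveRepin₁₃ F N) P k U ≤ Real.exp (w.ep (gOfRecord₁₃ F N (Θ.liveRepin₁₃ F N) P k) * (Fintype.card (Site (F.P P.K) k) : ℝ)))
    -- N12's displays, run by run, BELOW THE TORUS ONLY
    (h12pin : ∀ P : B12.RunParams, lamW.kSel P < P.K → lamW.D1100 P
      = rPrimeDataOfSel (reprTOfRecord₁₃ F N (Θ.liveRepin₁₃ F N) P (lamW.kSel P))
          ((Θ.liveRepin₁₃ F N).ppSel P (gOfRecord₁₃ F N (Θ.liveRepin₁₃ F N) P) (lamW.kSel P + 1))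
          (fibOfSeq F (Θ.liveRepin₁₃ F N).ν (Θ.liveRepin₁₃ F N).τ9 P (gOfRecord₁₃ F N (Θ.liveRepin₁₃ F N) P) (lamW.kSel P + 1)))
    (h12mass : ∀ P : B12.RunParams, lamW.kSel P < P.K → ∀ s, LiveSeq F N Θ.ν Θ.τ9 P (gOfRecord₁₃ F N (Θ.liveRepin₁₃ F N) P) (lamW.kSel P + 1)
        (slotsTOfRecord F N Θ.ν Θ.τ9 (EOfRecord₁₃ F N (Θ.liveRepin₁₃ F N)) (wOfRecord₉ F N (Θ.liveRepin₁₃ F N).toStage9Params)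
          (Θ.liveRepin₁₃ F N).ppSel P (gOfRecord₁₃ F N (Θ.liveRepin₁₃ F N) P) (lamW.kSel P + 1)) s →
      0 < ∫ V, rterm (reprTOfRecord₁₃ F N (Θ.liveRepin₁₃ F N) P (lamW.kSel P)) s V ∂(fieldMeasure (F.P P.K) (lamW.kSel P + 1) (SU N)))
    (h12P1 : ∀ P : B12.RunParams, lamW.kSel P < P.K → Prop1Printed (lamW.LF P))
    (h12i180 : ∀ P : B12.RunParams, lamW.kSel P < P.K → ∀ U, new189 (lamW.D189 P) U → ∀ i, (lamW.D189 P).h ≤ i → i ≤ (lamW.D189 P).k →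
      ∀ q ∈ plaqsOf (dom (lamW.D189 P) i),
        Ineq180 ((lamW.D189 P).dev0 U q) ((lamW.D189 P).ε (lamW.D189 P).k) (lamW.D189 P).η (lamW.D189 P).B₃ (lamW.D189 P).B₅ (lamW.D189 P).M (lamW.D189 P).δ
          ((lamW.D189 P).dist q) (lamW.D189 P).O1)
    (h12c189 : ∀ P : B12.RunParams, lamW.kSel P < P.K → Claim189 (new189 (lamW.D189 P)) (chiPP (lamW.D189 P)))
    (hsel : ∀ P : B12.RunParams, 1 ≤ P.K → lamW.kSel P < P.K) :
    ∃ (θ' : Stage13HParams F N) (h' : θ'.Provisos₁₃SepCoPH F N) (w : WorldP), (θ'.ZhUnity F N ∧ θ'.SlotsNondegenerate₁₃ F N) ∧ θ'.Admissible F N ∧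
      (∃ (θ'' : Stage13HParams F N) (h'' : θ''.Provisos₁₃SepCoPH F N), θ''.Admissible F N ∧
        datumOfRecord₁₃SepCoPH F N θ' h' = datumOfRecord₁₃SepCoPH F N θ'' h'' ∧ w.C = (datumOfRecord₁₃SepCoPH F N θ' h').C ∧ (0 < w.γ ∧ w.γ ≤ θ''.γ) ∧
        w.L = (θ''.L : ℝ) ∧ ∀ P : B12.RunParams, w.up P = upOfRecord₅CS F N (θ''.toStage5₁₃CoPH F N) P) ∧
      (∀ P : B12.RunParams, Nodes (leavesP w P)) ∧ PrintedUV3V N θ'.L ∧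
      ∃ lam : ResidW F N, (∀ P : B12.RunParams, 1 ≤ P.K → lam.kSel P < P.K) ∧
        ∀ P : B12.RunParams, lam.kSel P < P.K → ((leavesP w P).rBasicStep ↔ B15Leaf (WOfRecord₁₃ F N θ'.toStage13Params lam P)) := by
  have hn := nodes₁₃CoPH_upS_fourPinW₀_pointed (⟨⟨Θ.liveRepin₁₃ F N, Zr⟩, Zh, Phih⟩ : Stage13HParams F N) Mstar ops ζ W₀ w hP.toCore hθ.liveRepin₁₃ hC hγ hL hup h05S h06 h07 h08 h09 h09T h10 h11
    (fun P => by
      by_cases hk : lamW.kSel P < P.K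
      · rw [hW P hk]
        exact b15Leaf_WOfRecord₁₃_liveRepin₁₃_of_massLive_of_hasResiduals Θ lamW hres hk (h12pin P hk) (h12mass P hk) (h12P1 P hk) (h12i180 P hk) (h12c189 P hk)
      · exact hWdeg P (not_lt.1 hk))
    (fun P => laws₁₃CoPH_liveRepin₁₃_of_hasResiduals F N Θ Zr Zh Phih P hres hθ hκ hE₀ hB₀) hUV
  exact ⟨(⟨⟨Θ.liveRepin₁₃ F N, Zr⟩, Zh, Phih⟩ : Stage13HParams F N), hP, w, ⟨hZh, Stage13Params.slotsNondegenerate₁₃_liveRepin_of_hasResiduals hres⟩, hθ.liveRepin₁₃,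
    recordS₁₃SepCoPH_of_upS_pinB10YZW₀ (⟨⟨Θ.liveRepin₁₃ F N, Zr⟩, Zh, Phih⟩ : Stage13HParams F N) Mstar ops ζ W₀ w hP hθ.liveRepin₁₃ hC hγ hL hup, hn, h08,
    lamW, hsel, fun P hk => by
      rw [← hW P hk]
      show (w.up P).rBasicStep ↔ _
      rw [hup P]
      exact Iff.rfl⟩
end Live

/-! ## §2 ★★ AT THE DOOR-CURED PIN `Stage13HParams.ofHistoryBlind F N (Stage13RParams.ofCured F N (Θ.liveRepin₁₃ F N))` (FILE 27 §H1 ∘ K0a FILE 18) — `ZhUnity` a THEOREM, K1⁷-side input = K1⁵'s `Provisos₁₃SepCoP` lifted by `.ofCured` -/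
section Cured
variable (Θ : Stage13Params F N) (lamW : ResidW F N)
  (Mstar : ℕ) (ops : OpsY N (Θ.liveRepin₁₃ F N).toStage3Params Mstar) (ζ : ResidZ F N) (W₀ : B12.RunParams → PrintedCarriers15) (w : WorldP)

/-- **★★ THE v5 RUNG BODY AT THE DOOR-CURED PIN OF THE LIVE RE-PIN — `ZhUnity` DISCHARGED** (`(zrUnity_ofCured _).ofHistoryBlind`; §1 at `Zr := ZrOfRecord₁₃ F N (Θ.liveRepin₁₃ F N)`, `Zh := fun p _ _ _ => Zr p`, `Phih := fun p _ _ _ => (Rz p.K).phi`, `rfl`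
— the door-cured pin IS that H-extension by `rfl`, so N13 rides §1's instantiation of dag-n11-e's v1.7 row): K1⁷-SIDE INPUT = the v1.5 package `hP : (Θ.liveRepin₁₃).Provisos₁₃SepCoP` (K1⁵'s input VERBATIM, lifted by `.ofCured.ofHistoryBlind`) and
admissibility of `Θ`; world, rows, N12's displays below the torus, `hsel` as in §1.  The K0⁶ witnesses of record ARE cured pins of such live families (K0a FILE 18 §3–§4) and their door images are the K0⁷ ones (bridge ⁷ ⇐ ⁶
`IsRecordOfRecord₁₃CSepCoPH.ofCoPR`) — the rung body ON THE K0⁷ → K1⁷ ROAD.  COMPOSITE: nothing discharged as a node. [cite: Balaban1989LargeFieldII, Thm 1 p.355, (0.1) pp.355–356, p.387, p.391; Balaban1989LargeFieldI, (0.1) p.175, (0.2)–(0.6) p.176, p.177 (i)–(ii), Prop. 1 (1.78) p.194, (1.80) p.195, (1.89) p.198, (1.99)–(1.102) pp.200–201; Balaban1988Convergent, (1.11) p.248, p.244, Thm 1 p.262, (2.18) p.257, (3.16)–(3.25) pp.268–270; Balaban1985RegularSpaces, Lemma 1 – Thm 8 pp.79–101, Thm 8 (1.146) p.101 (surviving form);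 Balaban1985UV3, Thm 1 p.257, Thm 2 p.272; Balaban1985BackgroundPropagators, Thm 3.1 p.397; Balaban1985Variational, Thm 1 p.279; Balaban1987RG1, Thm 1 p.259, Lemma 4 p.280; Balaban1988RG2Cluster, Lemmas 1–3 pp.9–20 (bookkeeping)] -/
theorem nodesAtSomeRecordS₁₃SepCoPH_of_upS_fourPinW₀_ofHistoryBlind_ofCured_liveRepin₁₃_of_massLive_of_hasResiduals (hres : Θ.HasResidualsOfRecord F N)
    (hP : (Θ.liveRepin₁₃ F N).Provisos₁₃SepCoP F N) (hθ : Θ.Admissible F N)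
    (hκ : 0 ≤ Θ.s2.lf.κ) (hE₀ : 0 ≤ Θ.s2.lf.E₀) (hB₀ : 0 ≤ Θ.s2.lf.B₀)
    (hW : ∀ P : B12.RunParams, lamW.kSel P < P.K → W₀ P = WOfRecord₁₃ F N (Θ.liveRepin₁₃ F N) lamW P) (hWdeg : ∀ P : B12.RunParams, P.K ≤ lamW.kSel P → B15Leaf (W₀ P))
    (hC : w.C = (datumOfRecord₁₃SepCoPH F N (Stage13HParams.ofHistoryBlind F N (Stage13RParams.ofCured F N (Θ.liveRepin₁₃ F N))) hP.ofCured.ofHistoryBlind).C) (hγ : 0 < w.γ ∧ w.γ ≤ (Θ.liveRepin₁₃ F N).γ) (hL : w.L = ((Θ.liveRepin₁₃ F N).L : ℝ))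
    (hup : ∀ P, w.up P = upOfRecord₅CS F N ((((((Stage13HParams.ofHistoryBlind F N (Stage13RParams.ofCured F N (Θ.liveRepin₁₃ F N))).toStage5₁₃CoPH F N).pinB10 F N).pinY F N (Y9OfRecord N (Θ.liveRepin₁₃ F N).toStage3Params Mstar ops)).pinZ F N (Z11OfRecord F N ζ)).pinW F N W₀) P)
    (h05S : ∀ P : B12.RunParams, (upOfRecord₅CS F N ((((((Stage13HParams.ofHistoryBlind F N (Stage13RParams.ofCured F N (Θ.liveRepin₁₃ F N))).toStage5₁₃CoPH F N).pinB10 F N).pinY F N (Y9OfRecord N (Θ.liveRepin₁₃ F N).toStage3Params Mstar ops)).pinZ F N (Z11OfRecord F N ζ)).pinW F N W₀) P).b8)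
    (h06 : B9LeafX (Y9OfRecord N (Θ.liveRepin₁₃ F N).toStage3Params Mstar ops))
    (h07 : B11Leaf (Z11OfRecord F N ζ))
    (h08 : PrintedUV3V N (Θ.liveRepin₁₃ F N).L)
    (h09 : ∀ P : B12.RunParams, B12Sec2to5.Lemma4Printed ((Θ.liveRepin₁₃ F N).res.X P).F12 ((Θ.liveRepin₁₃ F N).res.X P).c12)
    (h09T : ∀ P : B12.RunParams, (leavesP w P).smallCouplings → (leavesP w P).smallFieldInductive)
    (h10 : ∀ P : B12.RunParams, B9LeafX (Y9OfRecord N (Θ.liveRepin₁₃ F N).toStage3Params Mstar ops) →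
      (B10.Thm1PrintedCompact (((((((Stage13HParams.ofHistoryBlind F N (Stage13RParams.ofCured F N (Θ.liveRepin₁₃ F N))).toStage5₁₃CoPH F N).pinB10 F N).pinY F N (Y9OfRecord N (Θ.liveRepin₁₃ F N).toStage3Params Mstar ops)).pinZ F N (Z11OfRecord F N ζ)).pinW F N W₀).res.X P).runs10 ∧
          B10.Thm2Printed (((((((Stage13HParams.ofHistoryBlind F N (Stage13RParams.ofCured F N (Θ.liveRepin₁₃ F N))).toStage5₁₃CoPH F N).pinB10 F N).pinY F N (Y9OfRecord N (Θ.liveRepin₁₃ F N).toStage3Params Mstar ops)).pinZ F N (Z11OfRecord F N ζ)).pinW F N W₀).res.X P).runs10) →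
        B11Leaf (Z11OfRecord F N ζ) → B12Sec2to5.Lemma4Printed ((Θ.liveRepin₁₃ F N).res.X P).F12 ((Θ.liveRepin₁₃ F N).res.X P).c12 →
          B13.Lemma1Printed ((Θ.liveRepin₁₃ F N).res.X P).S13 ((Θ.liveRepin₁₃ F N).res.X P).c13 ∧ B13.Lemma2Printed ((Θ.liveRepin₁₃ F N).res.X P).S13 ((Θ.liveRepin₁₃ F N).res.X P).c13 ∧
            B13.Lemma3Printed ((Θ.liveRepin₁₃ F N).res.X P).S13 ((Θ.liveRepin₁₃ F N).res.X P).c13)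
    (h11 : ∀ P : B12.RunParams, (leavesP w P).b7 → (leavesP w P).b8 → (leavesP w P).b9 → (leavesP w P).b10 → (leavesP w P).b11 →
      (leavesP w P).smallCouplings → (leavesP w P).smallFieldInductive → (leavesP w P).flowControl →
        ∀ k, k < P.K → SLaw₁₃CoPH F N (Stage13HParams.ofHistoryBlind F N (Stage13RParams.ofCured F N (Θ.liveRepin₁₃ F N))) P k → TLaw₁₃CoPH F N (Stage13HParams.ofHistoryBlind F N (Stage13RParams.ofCured F N (Θ.liveRepin₁₃ F N))) P k)
    (hUV : ∀ P : B12.RunParams, (genFlow (betaOfRecord₁₃ F N (Θ.liveRepin₁₃ F N)) P.g0).InInterval w.γ P.K → ∀ k, k ≤ P.K → SLaw₁₃CoPH F N (Stage13HParams.ofHistoryBlind F N (Stage13RParams.ofCured F N (Θ.liveRepin₁₃ F N))) P k →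
      ∀ U : GaugeField (F.P P.K) k (SU N),
        chiβOfRecord₁₃ F N (Θ.liveRepin₁₃ F N) P.K (gOfRecord₁₃ F N (Θ.liveRepin₁₃ F N) P) k U *
              Real.exp (-(1 / (gOfRecord₁₃ F N (Θ.liveRepin₁₃ F N) P k) ^ 2 * wilsonBGOfRecord F N (Θ.liveRepin₁₃ F N).εbg P k U)
                - w.em (gOfRecord₁₃ F N (Θ.liveRepin₁₃ F N) P k) * (Fintype.card (Site (F.P P.K) k) : ℝ)) ≤ densOfRecord₁₃ F N (Θ.liveRepin₁₃ F N) P k U ∧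
        densOfRecord₁₃ F N (Θ.liveRepin₁₃ F N) P k U ≤ Real.exp (w.ep (gOfRecord₁₃ F N (Θ.liveRepin₁₃ F N) P k) * (Fintype.card (Site (F.P P.K) k) : ℝ)))
    (h12pin : ∀ P : B12.RunParams, lamW.kSel P < P.K → lamW.D1100 P
      = rPrimeDataOfSel (reprTOfRecord₁₃ F N (Θ.liveRepin₁₃ F N) P (lamW.kSel P))
          ((Θ.liveRepin₁₃ F N).ppSel P (gOfRecord₁₃ F N (Θ.liveRepin₁₃ F N) P) (lamW.kSel P + 1))
          (fibOfSeq F (Θ.liveRepin₁₃ F N).ν (Θ.liveRepin₁₃ F N).τ9 P (gOfRecord₁₃ F N (Θ.liveRepin₁₃ F N) P) (lamW.kSel P + 1)))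
    (h12mass : ∀ P : B12.RunParams, lamW.kSel P < P.K → ∀ s, LiveSeq F N Θ.ν Θ.τ9 P (gOfRecord₁₃ F N (Θ.liveRepin₁₃ F N) P) (lamW.kSel P + 1)
        (slotsTOfRecord F N Θ.ν Θ.τ9 (EOfRecord₁₃ F N (Θ.liveRepin₁₃ F N)) (wOfRecord₉ F N (Θ.liveRepin₁₃ F N).toStage9Params)
          (Θ.liveRepin₁₃ F N).ppSel P (gOfRecord₁₃ F N (Θ.liveRepin₁₃ F N) P) (lamW.kSel P + 1)) s →
      0 < ∫ V, rterm (reprTOfRecord₁₃ F N (Θ.liveRepin₁₃ F N) P (lamW.kSel P)) s V ∂(fieldMeasure (F.P P.K) (lamW.kSel P + 1) (SU N)))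
    (h12P1 : ∀ P : B12.RunParams, lamW.kSel P < P.K → Prop1Printed (lamW.LF P))
    (h12i180 : ∀ P : B12.RunParams, lamW.kSel P < P.K → ∀ U, new189 (lamW.D189 P) U → ∀ i, (lamW.D189 P).h ≤ i → i ≤ (lamW.D189 P).k →
      ∀ q ∈ plaqsOf (dom (lamW.D189 P) i),
        Ineq180 ((lamW.D189 P).dev0 U q) ((lamW.D189 P).ε (lamW.D189 P).k) (lamW.D189 P).η (lamW.D189 P).B₃ (lamW.D189 P).B₅ (lamW.D189 P).M (lamW.D189 P).δ
          ((lamW.D189 P).dist q) (lamW.D189 P).O1)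
    (h12c189 : ∀ P : B12.RunParams, lamW.kSel P < P.K → Claim189 (new189 (lamW.D189 P)) (chiPP (lamW.D189 P)))
    (hsel : ∀ P : B12.RunParams, 1 ≤ P.K → lamW.kSel P < P.K) :
    ∃ (θ' : Stage13HParams F N) (h' : θ'.Provisos₁₃SepCoPH F N) (w : WorldP), (θ'.ZhUnity F N ∧ θ'.SlotsNondegenerate₁₃ F N) ∧ θ'.Admissible F N ∧
      (∃ (θ'' : Stage13HParams F N) (h'' : θ''.Provisos₁₃SepCoPH F N), θ''.Admissible F N ∧
        datumOfRecord₁₃SepCoPH F N θ' h' = datumOfRecord₁₃SepCoPH F N θ'' h'' ∧ w.C = (datumOfRecord₁₃SepCoPH F N θ' h').C ∧ (0 < w.γ ∧ w.γ ≤ θ''.γ) ∧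
        w.L = (θ''.L : ℝ) ∧ ∀ P : B12.RunParams, w.up P = upOfRecord₅CS F N (θ''.toStage5₁₃CoPH F N) P) ∧
      (∀ P : B12.RunParams, Nodes (leavesP w P)) ∧ PrintedUV3V N θ'.L ∧
      ∃ lam : ResidW F N, (∀ P : B12.RunParams, 1 ≤ P.K → lam.kSel P < P.K) ∧
        ∀ P : B12.RunParams, lam.kSel P < P.K → ((leavesP w P).rBasicStep ↔ B15Leaf (WOfRecord₁₃ F N θ'.toStage13Params lam P)) :=
  nodesAtSomeRecordS₁₃SepCoPH_of_upS_fourPinW₀_liveRepin₁₃H_of_massLive_of_hasResiduals Θ (ZrOfRecord₁₃ F N (Θ.liveRepin₁₃ F N)) (fun p _ _ _ => (Stage13RParams.ofCured F N (Θ.liveRepin₁₃ F N)).Zr p)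
    (fun p _ _ _ => ((Stage13RParams.ofCured F N (Θ.liveRepin₁₃ F N)).Rz p.K).phi) lamW Mstar ops ζ W₀ w hres hP.ofCured.ofHistoryBlind hθ (Stage13RParams.zrUnity_ofCured (Θ.liveRepin₁₃ F N)).ofHistoryBlind
    hκ hE₀ hB₀ hW hWdeg hC hγ hL hup h05S h06 h07 h08 h09 h09T h10 h11 hUV h12pin h12mass h12P1 h12i180 h12c189 hsel
end Cured

/-! ## §3 ★★★ AT THE DOOR-CURED PIN OF THE C¹ ROUTE's WITNESS `θ₁₅ᶜᶜ¹ = theta13OfThm1CC1 F N ε₀ ε₂₉ B₃ B₃' a₀ a₁` (node00-def-K0a FILE 13a; K0⁶'s Cuts A ∕ B′ ∕ B″ of FILE 18 §4 present `ofCured θ₁₅ᶜᶜ¹`-type witnesses) -/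
section CuredThm1CC1
variable (ε₀ ε₂₉ B₃ B₃' a₀ a₁ : ℝ) (lamW : ResidW F N)
  (Mstar : ℕ) (ops : OpsY N (theta13OfThm1CC1 F N ε₀ ε₂₉ B₃ B₃' a₀ a₁).toStage3Params Mstar) (ζ : ResidZ F N) (W₀ : B12.RunParams → PrintedCarriers15) (w : WorldP)

/-- **★★★ THE v4 RUNG BODY AT THE CURED PIN OF `θ₁₅ᶜᶜ¹`, N12 AND N13 RESOLVED** (§2 at `Θ := theta13OfNumerics … (stage12NumericsOfThm1CC1 F.L ε₀ B₃ B₃' a₀ a₁) …`, whose ₁₃ live re-pin IS `θ₁₅ᶜᶜ¹` by `rfl`; K0b's residuals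
`hasResidualsOfRecord_theta13OfNumerics`, admissibility `admissible_theta13OfNumerics` under the six witness signs, the three term-constant signs by 12L §3): K1⁷-SIDE INPUT = the v1.5 `hP : Provisos₁₃SepCoP θ₁₅ᶜᶜ¹` ALONE; the world binding, rows
h05S–h11 ∕ hUV, the layer `lamW` with `hsel`, the mixed pin and N12's per-run displays below the torus.  COMPOSITE: nothing discharged as a node. [cite: Balaban1989LargeFieldII, Thm 1 p.355, (0.1) pp.355–356, p.387, p.391; Balaban1989LargeFieldI, (0.1) p.175, (0.2)–(0.6) p.176, p.177 (i)–(ii), Prop. 1 (1.78) p.194, (1.80) p.195, (1.89) p.198, (1.99)–(1.102) pp.200–201; Balaban1988Convergent, (1.11) p.248, p.244, Thm 1 p.262, (2.18) p.257, (3.16)–(3.25) pp.268–270; Balaban1985RegularSpaces, Lemma 1 – Thm 8 pp.79–101, Thm 8 (1.146) p.101 (surviving form); Balaban1985UV3, Thm 1 p.257, Thm 2 p.272; Balaban1985BackgroundPropagators, Thm 3.1 p.397; Balaban1985Variational, Thm 1 p.279; Balaban1987RG1, Thm 1 p.259, Lemma 4 p.280; Balaban1988RG2Cluster, Lemmas 1–3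 pp.9–20 (bookkeeping)] -/
theorem nodesAtSomeRecordS₁₃SepCoPH_of_upS_fourPinW₀_ofHistoryBlind_ofCured_theta13OfThm1CC1_of_massLive
    (hε : 0 < ε₀) (hε' : 0 < ε₂₉) (hB : 0 ≤ B₃) (hB' : 0 ≤ B₃') (ha₀ : 0 < a₀) (ha₁ : 0 < a₁)
    (hP : (theta13OfThm1CC1 F N ε₀ ε₂₉ B₃ B₃' a₀ a₁).Provisos₁₃SepCoP F N)
    (hW : ∀ P : B12.RunParams, lamW.kSel P < P.K → W₀ P = WOfRecord₁₃ F N (theta13OfThm1CC1 F N ε₀ ε₂₉ B₃ B₃' a₀ a₁) lamW P) (hWdeg : ∀ P : B12.RunParams, P.K ≤ lamW.kSel P → B15Leaf (W₀ P))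
    (hC : w.C = (datumOfRecord₁₃SepCoPH F N (Stage13HParams.ofHistoryBlind F N (Stage13RParams.ofCured F N (theta13OfThm1CC1 F N ε₀ ε₂₉ B₃ B₃' a₀ a₁))) hP.ofCured.ofHistoryBlind).C) (hγ : 0 < w.γ ∧ w.γ ≤ (theta13OfThm1CC1 F N ε₀ ε₂₉ B₃ B₃' a₀ a₁).γ) (hL : w.L = ((theta13OfThm1CC1 F N ε₀ ε₂₉ B₃ B₃' a₀ a₁).L : ℝ))
    (hup : ∀ P, w.up P = upOfRecord₅CS F N ((((((Stage13HParams.ofHistoryBlind F N (Stage13RParams.ofCured F N (theta13OfThm1CC1 F N ε₀ ε₂₉ B₃ B₃' a₀ a₁))).toStage5₁₃CoPH F N).pinB10 F N).pinY F N (Y9OfRecord N (theta13OfThm1CC1 F N ε₀ ε₂₉ B₃ B₃' a₀ a₁).toStage3Params Mstar ops)).pinZ F N (Z11OfRecord F N ζ)).pinW F N W₀) P)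
    (h05S : ∀ P : B12.RunParams, (upOfRecord₅CS F N ((((((Stage13HParams.ofHistoryBlind F N (Stage13RParams.ofCured F N (theta13OfThm1CC1 F N ε₀ ε₂₉ B₃ B₃' a₀ a₁))).toStage5₁₃CoPH F N).pinB10 F N).pinY F N (Y9OfRecord N (theta13OfThm1CC1 F N ε₀ ε₂₉ B₃ B₃' a₀ a₁).toStage3Params Mstar ops)).pinZ F N (Z11OfRecord F N ζ)).pinW F N W₀) P).b8)
    (h06 : B9LeafX (Y9OfRecord N (theta13OfThm1CC1 F N ε₀ ε₂₉ B₃ B₃' a₀ a₁).toStage3Params Mstar ops))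
    (h07 : B11Leaf (Z11OfRecord F N ζ))
    (h08 : PrintedUV3V N (theta13OfThm1CC1 F N ε₀ ε₂₉ B₃ B₃' a₀ a₁).L)
    (h09 : ∀ P : B12.RunParams, B12Sec2to5.Lemma4Printed ((theta13OfThm1CC1 F N ε₀ ε₂₉ B₃ B₃' a₀ a₁).res.X P).F12 ((theta13OfThm1CC1 F N ε₀ ε₂₉ B₃ B₃' a₀ a₁).res.X P).c12)
    (h09T : ∀ P : B12.RunParams, (leavesP w P).smallCouplings → (leavesP w P).smallFieldInductive)
    (h10 : ∀ P : B12.RunParams, B9LeafX (Y9OfRecord N (theta13OfThm1CC1 F N ε₀ ε₂₉ B₃ B₃' a₀ a₁).toStage3Params Mstar ops) →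
      (B10.Thm1PrintedCompact (((((((Stage13HParams.ofHistoryBlind F N (Stage13RParams.ofCured F N (theta13OfThm1CC1 F N ε₀ ε₂₉ B₃ B₃' a₀ a₁))).toStage5₁₃CoPH F N).pinB10 F N).pinY F N (Y9OfRecord N (theta13OfThm1CC1 F N ε₀ ε₂₉ B₃ B₃' a₀ a₁).toStage3Params Mstar ops)).pinZ F N (Z11OfRecord F N ζ)).pinW F N W₀).res.X P).runs10 ∧
          B10.Thm2Printed (((((((Stage13HParams.ofHistoryBlind F N (Stage13RParams.ofCured F N (theta13OfThm1CC1 F N ε₀ ε₂₉ B₃ B₃' a₀ a₁))).toStage5₁₃CoPH F N).pinB10 F N).pinY F N (Y9OfRecord N (theta13OfThm1CC1 F N ε₀ ε₂₉ B₃ B₃' a₀ a₁).toStage3Params Mstar ops)).pinZ F N (Z11OfRecord F N ζ)).pinW F N W₀).res.X P).runs10) →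
        B11Leaf (Z11OfRecord F N ζ) → B12Sec2to5.Lemma4Printed ((theta13OfThm1CC1 F N ε₀ ε₂₉ B₃ B₃' a₀ a₁).res.X P).F12 ((theta13OfThm1CC1 F N ε₀ ε₂₉ B₃ B₃' a₀ a₁).res.X P).c12 →
          B13.Lemma1Printed ((theta13OfThm1CC1 F N ε₀ ε₂₉ B₃ B₃' a₀ a₁).res.X P).S13 ((theta13OfThm1CC1 F N ε₀ ε₂₉ B₃ B₃' a₀ a₁).res.X P).c13 ∧ B13.Lemma2Printed ((theta13OfThm1CC1 F N ε₀ ε₂₉ B₃ B₃' a₀ a₁).res.X P).S13 ((theta13OfThm1CC1 F N ε₀ ε₂₉ B₃ B₃' a₀ a₁).res.X P).c13 ∧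
            B13.Lemma3Printed ((theta13OfThm1CC1 F N ε₀ ε₂₉ B₃ B₃' a₀ a₁).res.X P).S13 ((theta13OfThm1CC1 F N ε₀ ε₂₉ B₃ B₃' a₀ a₁).res.X P).c13)
    (h11 : ∀ P : B12.RunParams, (leavesP w P).b7 → (leavesP w P).b8 → (leavesP w P).b9 → (leavesP w P).b10 → (leavesP w P).b11 →
      (leavesP w P).smallCouplings → (leavesP w P).smallFieldInductive → (leavesP w P).flowControl →
        ∀ k, k < P.K → SLaw₁₃CoPH F N (Stage13HParams.ofHistoryBlind F N (Stage13RParams.ofCured F N (theta13OfThm1CC1 F N ε₀ ε₂₉ B₃ B₃' a₀ a₁))) P k → TLaw₁₃CoPH F N (Stage13HParams.ofHistoryBlind F N (Stage13RParams.ofCured F N (theta13OfThm1CC1 F N ε₀ ε₂₉ B₃ B₃' a₀ a₁))) P k)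
    (hUV : ∀ P : B12.RunParams, (genFlow (betaOfRecord₁₃ F N (theta13OfThm1CC1 F N ε₀ ε₂₉ B₃ B₃' a₀ a₁)) P.g0).InInterval w.γ P.K → ∀ k, k ≤ P.K → SLaw₁₃CoPH F N (Stage13HParams.ofHistoryBlind F N (Stage13RParams.ofCured F N (theta13OfThm1CC1 F N ε₀ ε₂₉ B₃ B₃' a₀ a₁))) P k →
      ∀ U : GaugeField (F.P P.K) k (SU N),
        chiβOfRecord₁₃ F N (theta13OfThm1CC1 F N ε₀ ε₂₉ B₃ B₃' a₀ a₁) P.K (gOfRecord₁₃ F N (theta13OfThm1CC1 F N ε₀ ε₂₉ B₃ B₃' a₀ a₁) P) k U *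
              Real.exp (-(1 / (gOfRecord₁₃ F N (theta13OfThm1CC1 F N ε₀ ε₂₉ B₃ B₃' a₀ a₁) P k) ^ 2 * wilsonBGOfRecord F N (theta13OfThm1CC1 F N ε₀ ε₂₉ B₃ B₃' a₀ a₁).εbg P k U)
                - w.em (gOfRecord₁₃ F N (theta13OfThm1CC1 F N ε₀ ε₂₉ B₃ B₃' a₀ a₁) P k) * (Fintype.card (Site (F.P P.K) k) : ℝ)) ≤ densOfRecord₁₃ F N (theta13OfThm1CC1 F N ε₀ ε₂₉ B₃ B₃' a₀ a₁) P k U ∧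
        densOfRecord₁₃ F N (theta13OfThm1CC1 F N ε₀ ε₂₉ B₃ B₃' a₀ a₁) P k U ≤ Real.exp (w.ep (gOfRecord₁₃ F N (theta13OfThm1CC1 F N ε₀ ε₂₉ B₃ B₃' a₀ a₁) P k) * (Fintype.card (Site (F.P P.K) k) : ℝ)))
    (h12pin : ∀ P : B12.RunParams, lamW.kSel P < P.K → lamW.D1100 P
      = rPrimeDataOfSel (reprTOfRecord₁₃ F N (theta13OfThm1CC1 F N ε₀ ε₂₉ B₃ B₃' a₀ a₁) P (lamW.kSel P))
          ((theta13OfThm1CC1 F N ε₀ ε₂₉ B₃ B₃' a₀ a₁).ppSel P (gOfRecord₁₃ F N (theta13OfThm1CC1 F N ε₀ ε₂₉ B₃ B₃' a₀ a₁) P) (lamW.kSel P + 1))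
          (fibOfSeq F (theta13OfThm1CC1 F N ε₀ ε₂₉ B₃ B₃' a₀ a₁).ν (theta13OfThm1CC1 F N ε₀ ε₂₉ B₃ B₃' a₀ a₁).τ9 P (gOfRecord₁₃ F N (theta13OfThm1CC1 F N ε₀ ε₂₉ B₃ B₃' a₀ a₁) P) (lamW.kSel P + 1)))
    (h12mass : ∀ P : B12.RunParams, lamW.kSel P < P.K → ∀ s, LiveSeq F N (theta13OfThm1CC1 F N ε₀ ε₂₉ B₃ B₃' a₀ a₁).ν (theta13OfThm1CC1 F N ε₀ ε₂₉ B₃ B₃' a₀ a₁).τ9 P (gOfRecord₁₃ F N (theta13OfThm1CC1 F N ε₀ ε₂₉ B₃ B₃' a₀ a₁) P) (lamW.kSel P + 1)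
        (slotsTOfRecord F N (theta13OfThm1CC1 F N ε₀ ε₂₉ B₃ B₃' a₀ a₁).ν (theta13OfThm1CC1 F N ε₀ ε₂₉ B₃ B₃' a₀ a₁).τ9 (EOfRecord₁₃ F N (theta13OfThm1CC1 F N ε₀ ε₂₉ B₃ B₃' a₀ a₁)) (wOfRecord₉ F N (theta13OfThm1CC1 F N ε₀ ε₂₉ B₃ B₃' a₀ a₁).toStage9Params)
          (theta13OfThm1CC1 F N ε₀ ε₂₉ B₃ B₃' a₀ a₁).ppSel P (gOfRecord₁₃ F N (theta13OfThm1CC1 F N ε₀ ε₂₉ B₃ B₃' a₀ a₁) P) (lamW.kSel P + 1)) s →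
      0 < ∫ V, rterm (reprTOfRecord₁₃ F N (theta13OfThm1CC1 F N ε₀ ε₂₉ B₃ B₃' a₀ a₁) P (lamW.kSel P)) s V ∂(fieldMeasure (F.P P.K) (lamW.kSel P + 1) (SU N)))
    (h12P1 : ∀ P : B12.RunParams, lamW.kSel P < P.K → Prop1Printed (lamW.LF P))
    (h12i180 : ∀ P : B12.RunParams, lamW.kSel P < P.K → ∀ U, new189 (lamW.D189 P) U → ∀ i, (lamW.D189 P).h ≤ i → i ≤ (lamW.D189 P).k →
      ∀ q ∈ plaqsOf (dom (lamW.D189 P) i),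
        Ineq180 ((lamW.D189 P).dev0 U q) ((lamW.D189 P).ε (lamW.D189 P).k) (lamW.D189 P).η (lamW.D189 P).B₃ (lamW.D189 P).B₅ (lamW.D189 P).M (lamW.D189 P).δ
          ((lamW.D189 P).dist q) (lamW.D189 P).O1)
    (h12c189 : ∀ P : B12.RunParams, lamW.kSel P < P.K → Claim189 (new189 (lamW.D189 P)) (chiPP (lamW.D189 P)))
    (hsel : ∀ P : B12.RunParams, 1 ≤ P.K → lamW.kSel P < P.K) :
    ∃ (θ' : Stage13HParams F N) (h' : θ'.Provisos₁₃SepCoPH F N) (w : WorldP), (θ'.ZhUnity F N ∧ θ'.SlotsNondegenerate₁₃ F N) ∧ θ'.Admissible F N ∧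
      (∃ (θ'' : Stage13HParams F N) (h'' : θ''.Provisos₁₃SepCoPH F N), θ''.Admissible F N ∧
        datumOfRecord₁₃SepCoPH F N θ' h' = datumOfRecord₁₃SepCoPH F N θ'' h'' ∧ w.C = (datumOfRecord₁₃SepCoPH F N θ' h').C ∧ (0 < w.γ ∧ w.γ ≤ θ''.γ) ∧
        w.L = (θ''.L : ℝ) ∧ ∀ P : B12.RunParams, w.up P = upOfRecord₅CS F N (θ''.toStage5₁₃CoPH F N) P) ∧
      (∀ P : B12.RunParams, Nodes (leavesP w P)) ∧ PrintedUV3V N θ'.L ∧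
      ∃ lam : ResidW F N, (∀ P : B12.RunParams, 1 ≤ P.K → lam.kSel P < P.K) ∧
        ∀ P : B12.RunParams, lam.kSel P < P.K → ((leavesP w P).rBasicStep ↔ B15Leaf (WOfRecord₁₃ F N θ'.toStage13Params lam P)) :=
  nodesAtSomeRecordS₁₃SepCoPH_of_upS_fourPinW₀_ofHistoryBlind_ofCured_liveRepin₁₃_of_massLive_of_hasResiduals
    (theta13OfNumerics F N (stage12NumericsOfThm1CC1 F.L ε₀ B₃ B₃' a₀ a₁) ε₂₉ (zeta316OfRecord F N (stage12NumericsOfThm1CC1 F.L ε₀ B₃ B₃' a₀ a₁).ν (stage12NumericsOfThm1CC1 F.L ε₀ B₃ B₃' a₀ a₁).τ9.M (stage12NumericsOfThm1CC1 F.L ε₀ B₃ B₃' a₀ a₁).A₁) (RzOfRecord F N) (ZtOfRecord F N)) lamW Mstar ops ζ W₀ w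
    (hasResidualsOfRecord_theta13OfNumerics F N (stage12NumericsOfThm1CC1 F.L ε₀ B₃ B₃' a₀ a₁) ε₂₉) hP
    (admissible_theta13OfNumerics F N (zeta316OfRecord F N (stage12NumericsOfThm1CC1 F.L ε₀ B₃ B₃' a₀ a₁).ν (stage12NumericsOfThm1CC1 F.L ε₀ B₃ B₃' a₀ a₁).τ9.M (stage12NumericsOfThm1CC1 F.L ε₀ B₃ B₃' a₀ a₁).A₁) (RzOfRecord F N) (ZtOfRecord F N) (stage12NumericsOfThm1CC1_pos hε hB hB' ha₀ ha₁) hε')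
    (kappa_nonneg_theta13OfThm1CC1 F N ε₀ ε₂₉ B₃ B₃' a₀ a₁) (E0_nonneg_theta13OfThm1CC1 F N ε₀ ε₂₉ B₃ B₃' a₀ a₁) (B0_nonneg_theta13OfThm1CC1 F N ε₀ ε₂₉ B₃ B₃' a₀ a₁)
    hW hWdeg hC hγ hL hup h05S h06 h07 h08 h09 h09T h10 h11 hUV h12pin h12mass h12P1 h12i180 h12c189 hsel

end CuredThm1CC1

end Summit.QuantumFields.YangMills.BalabanUVNodes.N12AtRecord13SepCoPHSockets
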